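import Literature.Geometry.Lorentzian.CoordParallelFieldCurves
import Literature.Geometry.Lorentzian.CoordNullRicciParallel
import Mathlib.Analysis.SpecialFunctions.Log.Deriv
import HarnessLib

/-!
# Leaf calculus of a degenerate three-dimensional gradient soliton, in coordinates

For metric components `G` (the `MetricCoord` layer) in dimension three carrying a smooth PARALLEL
unit field `v` which is null for `Ric` (`Dv(X) + Γ(X,v) = 0`, `G(v,v) = 1`, `Ric(v,·) = 0`; the
conclusion of `CoordNullRicciParallel.lean` for a gradient soliton `Ric + Hess f = λG` with `Ric ≥ 0`,
`S > 0` and a null vector), whose Ricci form has at every point the algebraic type `(0, a, a)`: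

* `IsMetricOn.ricAt_eq_of_unit_null` — `Ric = (S/2)(G − θ ⊗ θ)` with `θ = G(v, ·)`, and
  `IsMetricOn.riemAt_unit_null_eq_zero` — `R(·, v) = 0` (from `CoordNullRicciStructure`);
* `IsMetricOn.hasFDerivAt_fderiv_apply_null` — for `u = df(v)`: `du = λ θ` (`∇v = 0` and the soliton
  equation with `Ric(v,·) = 0`);
* `IsMetricOn.fderiv_scalAt_eq_of_null` — `dS = S (df − u θ)` (`dS = 2Ric(∇f, ·)`);
* `IsMetricOn.gradSqAt_sub_eq_sq_of_null` — `|∇f|² − (2/S) Ric(∇f, ∇f) = u²` (so `u²` and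
  `ψ = f − u²/(2λ)` are expressible without `v`);
* `IsMetricOn.hasFDerivAt_log_scalAt_sub_of_null` — **`d(log S − ψ) = 0`**: `S e^{−ψ}` is locally
  constant (the two-dimensional soliton identity `dK = K df_Σ` on the leaves, `K = S/2`);
* along a solution `(γ, U, W)` of the geodesic / parallel system in `V`:
  `IsMetricOn.hasDerivAt_theta_velocity`, `IsMetricOn.hasDerivAt_theta_parallel` — `θ(γ̇)` and
  `θ(W)` are constant; `IsMetricOn.hasDerivAt_ricAt_parallel_of_null` —
  `d/dt Ric(W_a, W_b) = (dS(γ̇)/2)(G(W_a,W_b) − θ(W_a)θ(W_b))`;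
  `IsMetricOn.hasDerivAt_fderiv_apply_parallel` — `d/dt df(W) = Hess f(γ̇, W)`.

These are the pointwise identities behind the global structure of the degenerate case of the
classification of three-dimensional shrinkers (Munteanu–Wang 2016, Thm. 1.2: the cylinder
`S² × ℝ` and its quotients). Everything is proved; no definitions are introduced.

## References

* O. Munteanu, J. Wang, arXiv:1606.01861, Thm. 1.2 (p. 3). [MunteanuWang2016]
* P. Petersen, W. Wylie, Geom. Topol. 14 (2010), §3. [PetersenWylie2010]
* B. O'Neill, *Semi-Riemannian geometry*, 1983, Ch. 3, Prop. 3.13, Lemma 3.20, Lemma 3.49,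
  Lemma 3.52. [ONeill1983]
-/

noncomputable section

set_option maxSynthPendingDepth 3

open Set Filter Metric Module
open scoped Topology ContDiff

namespace Literature.Geometry.Lorentzian

namespace MetricCoord

variable {E : Type*} [NormedAddCommGroup E] [NormedSpace ℝ E] [FiniteDimensional ℝ E]
  [CompleteSpace E] {G : E → E →L[ℝ] E →L[ℝ] ℝ} {V : Set E} {z : E}

/-! ### Pointwise structure from a frame of type `(0, a, a)` and a unit null vector -/

section Pointwise

variable (e : Basis (Fin 3) ℝ E) (he : ∀ i j, G z (e i) (e j) = if i = j then 1 else 0)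
  {a : ℝ} (ha : a ≠ 0) (hμ : ∀ i w, ricAt G z (e i) w = (if i = 0 then 0 else a) * G z (e i) w)
  {v₀ : E} (hunit : G z v₀ v₀ = 1) (hnull : ∀ Z, ricAt G z v₀ Z = 0)
include he ha hμ hunit hnull

/-- A unit null vector of a Ricci form of type `(0,a,a)`, `a ≠ 0`, is `± e₀`:
`v₀ = c e₀` with `c² = 1`. [cite: ONeill1983, Ch. 3, Lemma 3.52] -/
theorem IsMetricOn.exists_unit_null_eq_smul (hG : IsMetricOn G V) (hz : z ∈ V) :
    ∃ c : ℝ, c ^ 2 = 1 ∧ v₀ = c • e 0 := by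
  have hs := hG.symm z hz
  have hc : ∀ j, j ≠ 0 → G z v₀ (e j) = 0 := by
    intro j hj
    have h1 : ricAt G z (e j) v₀ = (if j = 0 then 0 else a) * G z (e j) v₀ := hμ j v₀
    rw [hG.ricAt_comm hz, hnull, if_neg hj] at h1
    have h2 : G z (e j) v₀ = 0 := by
      rcases mul_eq_zero.mp h1.symm with h | h
      · exact (ha h).elim
      · exact h
    rw [hs]; exact h2
  have hv : v₀ = G z v₀ (e 0) • e 0 := by
    conv_lhs => rw [← sum_apply_smul_of_orthonormal e he v₀]
    rw [Fin.sum_univ_three, hc 1 (by decide), hc 2 (by decide), zero_smul, zero_smul, add_zero,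
      add_zero]
  refine ⟨G z v₀ (e 0), ?_, hv⟩
  have h1 : G z v₀ v₀ = G z v₀ (e 0) ^ 2 * G z (e 0) (e 0) := by
    conv_lhs => rw [hv]
    simp only [map_smul, _root_.smul_apply, smul_eq_mul]
    ring
  rw [hunit, he] at h1
  simp only [if_true, mul_one] at h1
  exact h1.symm

/-- **`Ric = (S/2)(G − θ⊗θ)`, `θ = G(v₀,·)`**, for a unit null vector `v₀` of a Ricci form of type
`(0,a,a)`. [cite: ONeill1983, Ch. 3, Lemma 3.52] [cite: PetersenWylie2010, §3] -/
theorem IsMetricOn.ricAt_eq_of_unit_null (hG : IsMetricOn G V) (hz : z ∈ V) (W Z : E) :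
    ricAt G z W Z = scalAt G z / 2 * (G z W Z - G z v₀ W * G z v₀ Z) := by
  have hs := hG.symm z hz
  have hi := hG.isInvertible z hz
  obtain ⟨c, hc2, hv⟩ := hG.exists_unit_null_eq_smul e he ha hμ hunit hnull hz
  have hS : scalAt G z = 2 * a := by
    rw [scalAt_eq_sum_of_eigenframe e he hμ hi, Fin.sum_univ_three]
    simp only [Fin.isValue, if_true, show (1 : Fin 3) ≠ 0 from by decide,
      show (2 : Fin 3) ≠ 0 from by decide, if_false]
    ring
  have hprod : G z v₀ W * G z v₀ Z = G z (e 0) W * G z (e 0) Z := by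
    rw [hv]
    simp only [map_smul, _root_.smul_apply, smul_eq_mul]
    have : c * G z (e 0) W * (c * G z (e 0) Z) = c ^ 2 * (G z (e 0) W * G z (e 0) Z) := by ring
    rw [this, hc2, one_mul]
  rw [ricAt_eq_of_null_eigenframe e he hμ hs W Z, hprod, hS]
  ring

/-- **The null direction is in the nullity of the curvature**: `R(W, v₀) = 0`.
[cite: ONeill1983, Ch. 3, Prop. 3.36] -/
theorem IsMetricOn.riemAt_unit_null_eq_zero (hG : IsMetricOn G V) (hz : z ∈ V) (W : E) :
    riemAt G z W v₀ = 0 := by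
  obtain ⟨c, -, hv⟩ := hG.exists_unit_null_eq_smul e he ha hμ hunit hnull hz
  rw [hv, riemAt_smul_right, hG.riemAt_null_eq_zero e he hμ hz W, smul_zero]

end Pointwise

/-! ### Derivatives along the parallel null field -/

section Field

variable (hG : IsMetricOn G V) {f : E → ℝ} {lam : ℝ} (hf : ContDiffOn ℝ ∞ f V)
  (hsol : ∀ y ∈ V, ∀ u w, ricAt G y u w + hessAt G f y u w = lam * G y u w)
  {v : E → E} (hv : ContDiffOn ℝ ∞ v V)
  (hpar : ∀ z ∈ V, ∀ X, fderiv ℝ v z X + chrAt G z X (v z) = 0)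
  (hunit : ∀ z ∈ V, G z (v z) (v z) = 1) (hnull : ∀ z ∈ V, ∀ Z, ricAt G z (v z) Z = 0)
  (hRic : ∀ z ∈ V, ∀ W Z, ricAt G z W Z = scalAt G z / 2 * (G z W Z - G z (v z) W * G z (v z) Z))
include hG hf hsol hv hpar hunit hnull hRic

omit [FiniteDimensional ℝ E] [CompleteSpace E] in
omit hsol hv hpar hunit hnull hRic in
/-- `f` is differentiable at the points of `V`. [folklore] -/
private theorem hasFDerivAt_f (hz : z ∈ V) : HasFDerivAt f (fderiv ℝ f z) z :=
  ((hf.contDiffAt (hG.mem_nhds hz)).differentiableAt (by simp)).hasFDerivAt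

omit hunit hRic in
/-- **`du = λ θ`** for `u = df(v)`: `d(df(v))(w) = D²f(w, v) + df(Dv(w)) = Hess f(w, v) = λ G(w,v)`
(`∇v = 0`, and the soliton equation with `Ric(v, ·) = 0`). [cite: PetersenWylie2010, §3] -/
theorem IsMetricOn.hasFDerivAt_fderiv_apply_null (hz : z ∈ V) :
    HasFDerivAt (fun y ↦ fderiv ℝ f y (v y)) (lam • G z (v z)) z := by
  have hfc : ContDiffAt ℝ ∞ f z := hf.contDiffAt (hG.mem_nhds hz)
  have hDf : HasFDerivAt (fderiv ℝ f) (fderiv ℝ (fderiv ℝ f) z) z :=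
    ((hfc.fderiv_right (m := ∞) (by simp)).differentiableAt (by simp)).hasFDerivAt
  have hvd : HasFDerivAt v (fderiv ℝ v z) z :=
    ((hv.contDiffAt (hG.mem_nhds hz)).differentiableAt (by simp)).hasFDerivAt
  have h := hDf.clm_apply hvd
  refine h.congr_fderiv ?_
  ext w
  simp only [_root_.add_apply, ContinuousLinearMap.comp_apply,
    ContinuousLinearMap.flip_apply, FunLike.coe_smul, Pi.smul_apply, smul_eq_mul]
  have hp : fderiv ℝ v z w = -chrAt G z w (v z) := eq_neg_of_add_eq_zero_left (hpar z hz w)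
  have hs := hsol z hz w (v z)
  rw [hG.ricAt_comm hz, hnull z hz, zero_add, hessAt_apply] at hs
  rw [hp, map_neg, hG.symm z hz (v z) w, ← hs]
  ring

omit hv hpar hunit hnull in
/-- **`dS = S (df − u θ)`**: `dS(w) = 2 Ric(∇f, w) = S (G(∇f, w) − θ(∇f) θ(w))`.
[cite: MunteanuWang2016, §2 (p. 6)] [cite: PetersenWylie2010, §3] -/
theorem IsMetricOn.fderiv_scalAt_eq_of_null (hz : z ∈ V) (w : E) :
    fderiv ℝ (scalAt G) z w =
      scalAt G z * (fderiv ℝ f z w - fderiv ℝ f z (v z) * G z (v z) w) := by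
  have hi := hG.isInvertible z hz
  rw [hG.fderiv_scalAt_of_soliton hz hf hsol, hRic z hz, apply_sharpAt_apply hi,
    hG.symm z hz (v z) (sharpAt G z (fderiv ℝ f z)), apply_sharpAt_apply hi]
  ring

omit [CompleteSpace E] in
omit hf hsol hv hpar hunit hnull in
/-- **`|∇f|² − (2/S) Ric(∇f, ∇f) = u²`** (`Ric(∇f,∇f) = (S/2)(|∇f|² − u²)`): the square of
`u = df(v)` is expressible through `|∇f|²`, `S` and `Ric` alone. [cite: PetersenWylie2010, §3] -/
theorem IsMetricOn.gradSqAt_sub_eq_sq_of_null (hz : z ∈ V) (hS : scalAt G z ≠ 0) :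
    gradSqAt G f z - 2 / scalAt G z *
        ricAt G z (sharpAt G z (fderiv ℝ f z)) (sharpAt G z (fderiv ℝ f z)) =
      (fderiv ℝ f z (v z)) ^ 2 := by
  have hi := hG.isInvertible z hz
  rw [hRic z hz, apply_sharpAt_apply hi, hG.symm z hz (v z) (sharpAt G z (fderiv ℝ f z)),
    apply_sharpAt_apply hi, gradSqAt_apply]
  field_simp
  ring

omit hunit in
/-- **`d(log S − ψ) = 0`, `ψ = f − u²/(2λ)`**: `d log S = df − uθ` and `d(u²) = 2λ u θ`. So
`S e^{−ψ}` is locally constant: the two-dimensional soliton identity `dK = K df_Σ` on the leaves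
(`K = S/2`, `f_Σ = ψ`). [cite: PetersenWylie2010, §3] [cite: MunteanuWang2016, Thm. 1.1] -/
theorem IsMetricOn.hasFDerivAt_log_scalAt_sub_of_null (hz : z ∈ V) (hlam : lam ≠ 0)
    (hS : 0 < scalAt G z) :
    HasFDerivAt (fun y ↦ Real.log (scalAt G y) - (f y - (fderiv ℝ f y (v y)) ^ 2 / (2 * lam)))
      (0 : E →L[ℝ] ℝ) z := by
  have hSd : HasFDerivAt (scalAt G) (fderiv ℝ (scalAt G) z) z :=
    ((hG.contDiffAt_scalAt hz).differentiableAt (by simp)).hasFDerivAt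
  have hlog := hSd.log hS.ne'
  have hu := hG.hasFDerivAt_fderiv_apply_null hf hsol hv hpar hnull hz
  have hu2 : HasFDerivAt (fun y ↦ (fderiv ℝ f y (v y)) ^ 2)
      ((2 * fderiv ℝ f z (v z)) • (lam • G z (v z))) z := by
    have h := hu.pow 2
    simpa using h
  have hψ := (hasFDerivAt_f hG hf hz).sub (hu2.mul_const (2 * lam)⁻¹)
  have h := hlog.sub hψ
  have hfun : (fun y ↦ Real.log (scalAt G y) - (f y - (fderiv ℝ f y (v y)) ^ 2 / (2 * lam))) =
      fun y ↦ Real.log (scalAt G y) - (f y - (fderiv ℝ f y (v y)) ^ 2 * (2 * lam)⁻¹) := by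
    funext y; rw [div_eq_mul_inv]
  rw [hfun]
  refine h.congr_fderiv ?_
  ext w
  simp only [_root_.sub_apply, FunLike.coe_smul, Pi.smul_apply, smul_eq_mul, _root_.zero_apply]
  rw [hG.fderiv_scalAt_eq_of_null hf hsol hRic hz w]
  field_simp
  ring

end Field

/-! ### Along curves: the geodesic / parallel system with the null field -/

section Curve

variable (hG : IsMetricOn G V) {f : E → ℝ} {lam : ℝ} (hf : ContDiffOn ℝ ∞ f V)
  (hsol : ∀ y ∈ V, ∀ u w, ricAt G y u w + hessAt G f y u w = lam * G y u w)
  {v : E → E} (hv : ContDiffOn ℝ ∞ v V)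
  (hpar : ∀ z ∈ V, ∀ X, fderiv ℝ v z X + chrAt G z X (v z) = 0)
  (hunit : ∀ z ∈ V, G z (v z) (v z) = 1) (hnull : ∀ z ∈ V, ∀ Z, ricAt G z (v z) Z = 0)
  (hRic : ∀ z ∈ V, ∀ W Z, ricAt G z W Z = scalAt G z / 2 * (G z W Z - G z (v z) W * G z (v z) Z))
  {γ U : ℝ → E} {s : ℝ}
include hG hf hsol hv hpar hunit hnull hRic

omit [FiniteDimensional ℝ E] [CompleteSpace E] in
omit hf hsol hunit hnull hRic in
/-- **The null field is parallel along every curve**: `(v∘γ)'(s) = −Γ(γ'(s), v(γ(s)))`.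
[cite: ONeill1983, Ch. 3, Def. 3.49] -/
theorem IsMetricOn.hasDerivAt_null_field_comp (hγV : γ s ∈ V) (hγ : HasDerivAt γ (U s) s) :
    HasDerivAt (fun t ↦ v (γ t)) (-chrAt G (γ s) (U s) (v (γ s))) s := by
  have hvd : DifferentiableAt ℝ v (γ s) :=
    ((hv.contDiffAt (hG.mem_nhds hγV)).differentiableAt (by simp))
  have h := hvd.hasFDerivAt.comp_hasDerivAt s hγ
  refine h.congr_deriv ?_
  exact eq_neg_of_add_eq_zero_left (hpar (γ s) hγV (U s))

omit [FiniteDimensional ℝ E] [CompleteSpace E] in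
omit hf hsol hunit hnull hRic in
/-- **`θ(W)` is constant along a parallel field `W`** (`θ = G(v,·)`, `v` parallel: parallel
transport is isometric). [cite: ONeill1983, Ch. 3, Lemma 3.20] -/
theorem IsMetricOn.hasDerivAt_theta_parallel (hγV : γ s ∈ V) (hγ : HasDerivAt γ (U s) s)
    {W : ℝ → E} (hW : HasDerivAt W (-chrAt G (γ s) (U s) (W s)) s) :
    HasDerivAt (fun t ↦ G (γ t) (v (γ t)) (W t)) 0 s := by
  have hGγ : HasDerivAt (fun σ ↦ G (γ σ)) (fderiv ℝ G (γ s) (U s)) s :=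
    (hG.differentiableAt hγV).hasFDerivAt.comp_hasDerivAt s hγ
  have hvγ := hG.hasDerivAt_null_field_comp hv hpar hγV hγ
  have h := (hGγ.clm_apply hvγ).clm_apply hW
  refine h.congr_deriv ?_
  simp only [map_neg, _root_.add_apply, _root_.neg_apply, hG.fderiv_eq_chrAt hγV]
  abel

omit [FiniteDimensional ℝ E] [CompleteSpace E] in
omit hf hsol hunit hnull hRic in
/-- **`θ(γ̇)` is constant along a geodesic** (`U' = −Γ(U,U)`). [cite: ONeill1983, Ch. 3, Lemma 3.20] -/
theorem IsMetricOn.hasDerivAt_theta_velocity (hγV : γ s ∈ V) (hγ : HasDerivAt γ (U s) s)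
    (hU : HasDerivAt U (-chrAt G (γ s) (U s) (U s)) s) :
    HasDerivAt (fun t ↦ G (γ t) (v (γ t)) (U t)) 0 s :=
  hG.hasDerivAt_theta_parallel hv hpar hγV hγ hU

omit [FiniteDimensional ℝ E] [CompleteSpace E] in
omit hf hsol hv hpar hunit hnull hRic in
/-- **`G(W_a, W_b)` is constant along two parallel fields.** [cite: ONeill1983, Ch. 3, Lemma 3.20] -/
theorem IsMetricOn.hasDerivAt_metric_parallel (hγV : γ s ∈ V) (hγ : HasDerivAt γ (U s) s)
    {Wa Wb : ℝ → E} (hWa : HasDerivAt Wa (-chrAt G (γ s) (U s) (Wa s)) s)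
    (hWb : HasDerivAt Wb (-chrAt G (γ s) (U s) (Wb s)) s) :
    HasDerivAt (fun t ↦ G (γ t) (Wa t) (Wb t)) 0 s := by
  have hGγ : HasDerivAt (fun σ ↦ G (γ σ)) (fderiv ℝ G (γ s) (U s)) s :=
    (hG.differentiableAt hγV).hasFDerivAt.comp_hasDerivAt s hγ
  have h := (hGγ.clm_apply hWa).clm_apply hWb
  refine h.congr_deriv ?_
  simp only [map_neg, _root_.add_apply, _root_.neg_apply, hG.fderiv_eq_chrAt hγV]
  abel

omit hf hsol hunit hnull in
/-- **`d/dt Ric(W_a, W_b) = (dS(γ̇)/2)(G(W_a,W_b) − θ(W_a) θ(W_b))`** along parallel fields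
`W_a, W_b` (i.e. `∇_{γ̇} Ric = (dS(γ̇)/2)(G − θ⊗θ)`: `Ric = (S/2)(G − θ⊗θ)` with `∇G = 0`,
`∇θ = 0`). [cite: PetersenWylie2010, §3] [cite: ONeill1983, Ch. 3, Lemma 3.20] -/
theorem IsMetricOn.hasDerivAt_ricAt_parallel_of_null (hγV : γ s ∈ V) (hγ : HasDerivAt γ (U s) s)
    {Wa Wb : ℝ → E} (hWa : HasDerivAt Wa (-chrAt G (γ s) (U s) (Wa s)) s)
    (hWb : HasDerivAt Wb (-chrAt G (γ s) (U s) (Wb s)) s) :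
    HasDerivAt (fun t ↦ ricAt G (γ t) (Wa t) (Wb t))
      (fderiv ℝ (scalAt G) (γ s) (U s) / 2 *
        (G (γ s) (Wa s) (Wb s) - G (γ s) (v (γ s)) (Wa s) * G (γ s) (v (γ s)) (Wb s))) s := by
  -- the formula for `Ric` holds along the curve near `s`
  have hev : (fun t ↦ ricAt G (γ t) (Wa t) (Wb t)) =ᶠ[𝓝 s] fun t ↦ scalAt G (γ t) / 2 *
      (G (γ t) (Wa t) (Wb t) - G (γ t) (v (γ t)) (Wa t) * G (γ t) (v (γ t)) (Wb t)) := by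
    have hVn : ∀ᶠ t in 𝓝 s, γ t ∈ V := hγ.continuousAt.preimage_mem_nhds (hG.mem_nhds hγV)
    filter_upwards [hVn] with t ht
    exact hRic (γ t) ht (Wa t) (Wb t)
  refine HasDerivAt.congr_of_eventuallyEq ?_ hev
  have hSd : DifferentiableAt ℝ (scalAt G) (γ s) :=
    ((hG.contDiffAt_scalAt hγV).differentiableAt (by simp))
  have hS := hasDerivAt_comp_curve (γ := γ) (u := U) hSd hγ
  have hGab := hG.hasDerivAt_metric_parallel hγV hγ hWa hWb
  have hθa := hG.hasDerivAt_theta_parallel hv hpar hγV hγ hWa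
  have hθb := hG.hasDerivAt_theta_parallel hv hpar hγV hγ hWb
  have h : HasDerivAt (fun t ↦ scalAt G (γ t) / 2 *
      (G (γ t) (Wa t) (Wb t) - G (γ t) (v (γ t)) (Wa t) * G (γ t) (v (γ t)) (Wb t)))
      (fderiv ℝ (scalAt G) (γ s) (U s) / 2 *
          (G (γ s) (Wa s) (Wb s) - G (γ s) (v (γ s)) (Wa s) * G (γ s) (v (γ s)) (Wb s)) +
        scalAt G (γ s) / 2 *
          (0 - (0 * G (γ s) (v (γ s)) (Wb s) + G (γ s) (v (γ s)) (Wa s) * 0))) s :=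
    (hS.div_const 2).mul (hGab.sub (hθa.mul hθb))
  refine h.congr_deriv ?_
  ring

omit [FiniteDimensional ℝ E] [CompleteSpace E] in
omit hsol hv hpar hunit hnull hRic in
/-- **`d/dt df(W) = Hess f(γ̇, W)`** along a parallel field `W`:
`(df_γ(W))' = D²f(γ̇, W) + df(W') = D²f(γ̇,W) − df(Γ(γ̇,W))`. [cite: ONeill1983, Ch. 3, Lemma 3.49] -/
theorem IsMetricOn.hasDerivAt_fderiv_apply_parallel (hγV : γ s ∈ V) (hγ : HasDerivAt γ (U s) s)
    {W : ℝ → E} (hW : HasDerivAt W (-chrAt G (γ s) (U s) (W s)) s) :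
    HasDerivAt (fun t ↦ fderiv ℝ f (γ t) (W t)) (hessAt G f (γ s) (U s) (W s)) s := by
  have hDfd : DifferentiableAt ℝ (fderiv ℝ f) (γ s) :=
    (((hf.contDiffAt (hG.mem_nhds hγV)).fderiv_right (m := ∞) (by simp)).differentiableAt
      (by simp))
  have hDγ : HasDerivAt (fun σ ↦ fderiv ℝ f (γ σ)) (fderiv ℝ (fderiv ℝ f) (γ s) (U s)) s :=
    hDfd.hasFDerivAt.comp_hasDerivAt s hγ
  refine (hDγ.clm_apply hW).congr_deriv ?_
  rw [hessAt_apply, map_neg]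
  abel

omit [CompleteSpace E] in
omit hG hf hv hpar hunit hnull in
/-- **`Hess f(X, Y) = λ G(X,Y) − (S/2)(G(X,Y) − θ(X)θ(Y))`** on the degenerate soliton.
[cite: PetersenWylie2010, §3] -/
theorem IsMetricOn.hessAt_eq_of_null (hz : z ∈ V) (X Y : E) :
    hessAt G f z X Y = lam * G z X Y - scalAt G z / 2 * (G z X Y - G z (v z) X * G z (v z) Y) := by
  have h := hsol z hz X Y
  rw [hRic z hz] at h
  linarith

end Curve

end MetricCoord

end Literature.Geometry.Lorentzian

end
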